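import Mathlib
import Summits.MatrixMultiplication.MatrixMultiplication.Theorems.SnSubsetDichotomyHyperoctahedralThresholdSameColourDarts

/-!
# The same-colour supply, II: suffix stripping and the multi-scale inequality (15.1)
(crux `SnSubsetDichotomy.HyperoctahedralThreshold`, stmt-MatrixMultiplication-10883, line `refutation-local-symmetry`;
`--supports` helpers for the open stub `stub_poorRigidCore`; crux NOTES §15.1, the SUPPLY half of the supply/tip
dichotomy — second file, building on `…SameColourDarts`)

A **same-colour structure** of colour `c` and length `m` is `(a, w)` with `|w| = m`, `List.IsChain (· ≠ ·) (c :: (w ++ [c]))`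
and `(μ c a) · w = μ c (a · w)`; `Π_m(c)` denotes their number (written out as the cardinality of a filter of
`univ ×ˢ (univ : Finset (List.Vector (Fin 3) m)).image toList`).

* `coll_strip` (induction step): among the triples `(a, g, g')` of `…SameColourDarts.coll_lower` at length `k + 1`,
  those with different last letters are — injectively via `(a, g ++ g'.reverse)` — structures of length `2(k + 1)`,
  and those with a common last letter map at most 2-to-1 (the stripped letter avoids the new last letter, or `c`)
  to triples of length `k`; so `|Coll_{k+1}| ≤ Π_{2(k+1)}(c) + 2 |Coll_k|`.
* `sameColour_supply` (NOTES (15.1), density-free): for every colour `c`, `0 < n` and every `k`,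
  `4^k ≤ n · 2^k + Σ_{j<k} 2^j · Π_{2(k−j)}(c)`.
* `exists_scale`: if `2^k ≥ 2n`, some scale `m = 2(k − j)`, `j < k`, has `2k · 2^j · Π_m(c) ≥ 4^k`, i.e.
  `Π_m(c) ≥ 2^m · 2^{(2k−m)/2} / (2k)` — many same-colour structures at SOME scale `m ≤ 2k ≈ 2 log₂ n + O(1)`.

Together with the companion `…SameColourTip` (a structure whose non-end rung pairs are equal-or-disjoint closes the
stub's conclusion) this is the supply/tip dichotomy of crux NOTES §15: what remains for `stub_poorRigidCore` is to show
that poorness + rigidity make the interior defects of NOTES §15.2 rare at the scale picked here.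
Pure finite combinatorics; hypothesis only `μ d * μ d = 1`.  No definitions are introduced.
-/

set_option linter.dupNamespace false

namespace Summit.MatrixMultiplication.MatrixMultiplication.Theorems.HyperoctahedralThreshold.SameColourSupply

open GoodTwin

variable {n : ℕ}

/-- A word of length `k + 1` is a word of length `k` followed by a letter. -/
theorem exists_concat_of_length {k : ℕ} {g : List (Fin 3)} (hg : g.length = k + 1) :
    ∃ gi d, g = gi ++ [d] ∧ gi.length = k := by
  obtain ⟨gi, d, hgd⟩ := (List.eq_nil_or_concat g).resolve_left (by rintro rfl; simp at hg)
  rw [List.concat_eq_append] at hgd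
  subst hgd
  refine ⟨gi, d, rfl, ?_⟩
  simpa using hg

/-- Stripping a common last letter does not change the action of `g g'⁻¹` (letters are involutions). -/
theorem foldl_strip (μ : Fin 3 → Equiv.Perm (Fin n)) (hμ : ∀ d, μ d * μ d = 1) (gi gi' : List (Fin 3))
    (d : Fin 3) (x : Fin n) :
    ((gi ++ [d]) ++ (gi' ++ [d]).reverse).foldl (fun v e => μ e v) x =
      (gi ++ gi'.reverse).foldl (fun v e => μ e v) x := by
  simp only [List.reverse_append, List.reverse_cons, List.reverse_nil, List.nil_append, List.singleton_append,
    List.foldl_append, List.foldl_cons, List.foldl_nil]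
  rw [act_invol μ hμ]

/-- `c gi` is reduced if `c gi d` is. -/
theorem isChain_init {c d : Fin 3} {gi : List (Fin 3)} (hg : List.IsChain (· ≠ ·) (c :: (gi ++ [d]))) :
    List.IsChain (· ≠ ·) (c :: gi) := by
  have : List.IsChain (· ≠ ·) ((c :: gi) ++ [d]) := by simpa using hg
  exact this.left_of_append

/-- Glueing `c gi d` and the reverse of `c gi' d'` at different letters `d ≠ d'` gives the reduced word
`c gi d d' gi'⁻¹ c`. -/
theorem isChain_glue {c d d' : Fin 3} {gi gi' : List (Fin 3)} (hg : List.IsChain (· ≠ ·) (c :: (gi ++ [d])))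
    (hg' : List.IsChain (· ≠ ·) (c :: (gi' ++ [d']))) (hdd : d ≠ d') :
    List.IsChain (· ≠ ·) (c :: (((gi ++ [d]) ++ (gi' ++ [d']).reverse) ++ [c])) := by
  have e : c :: (((gi ++ [d]) ++ (gi' ++ [d']).reverse) ++ [c]) = (c :: gi) ++ (d :: d' :: (gi'.reverse ++ [c])) := by
    simp
  have hr : List.IsChain (· ≠ ·) (d' :: (gi'.reverse ++ [c])) := by
    have e' : (c :: (gi' ++ [d'])).reverse = d' :: (gi'.reverse ++ [c]) := by simp
    rw [← e']
    exact List.isChain_reverse.2 (hg'.imp fun a b (h : a ≠ b) => h.symm)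
  rw [e, List.isChain_append_cons_cons]
  exact ⟨by simpa using hg, hdd, hr⟩

/-- **Suffix stripping** (the induction step of NOTES (15.1)).  Among the triples `(a, g, g')` of length `k + 1`
(`c g`, `c g'` reduced, `g ≠ g'`, `(μ c a) · (g g'⁻¹) = μ c (a · g g'⁻¹)`), those whose last letters differ are —
injectively, via `(a, g ++ g'.reverse)` — same-colour structures of colour `c` and length `2k + 2`, and those with a
common last letter map at most 2-to-1 (the stripped letter avoids the new last letter) to triples of length `k`.
[this line] -/
theorem coll_strip (μ : Fin 3 → Equiv.Perm (Fin n)) (hμ : ∀ d, μ d * μ d = 1) (c : Fin 3) (k : ℕ) :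
    (((Finset.univ : Finset (Fin n)) ×ˢ
        ((((Finset.univ : Finset (List.Vector (Fin 3) (k + 1))).image (fun v => v.toList)).filter
            (fun g => List.IsChain (· ≠ ·) (c :: g))) ×ˢ
          (((Finset.univ : Finset (List.Vector (Fin 3) (k + 1))).image (fun v => v.toList)).filter
            (fun g => List.IsChain (· ≠ ·) (c :: g))))).filter
        (fun x => x.2.1 ≠ x.2.2 ∧
          (x.2.1 ++ x.2.2.reverse).foldl (fun v d => μ d v) (μ c x.1) =
            μ c ((x.2.1 ++ x.2.2.reverse).foldl (fun v d => μ d v) x.1))).card ≤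
      (((Finset.univ : Finset (Fin n)) ×ˢ
          ((Finset.univ : Finset (List.Vector (Fin 3) (2 * (k + 1)))).image (fun v => v.toList))).filter
        (fun aw => List.IsChain (· ≠ ·) (c :: (aw.2 ++ [c])) ∧
          aw.2.foldl (fun v d => μ d v) (μ c aw.1) = μ c (aw.2.foldl (fun v d => μ d v) aw.1))).card +
      2 * (((Finset.univ : Finset (Fin n)) ×ˢ
        ((((Finset.univ : Finset (List.Vector (Fin 3) k)).image (fun v => v.toList)).filter
            (fun g => List.IsChain (· ≠ ·) (c :: g))) ×ˢ
          (((Finset.univ : Finset (List.Vector (Fin 3) k)).image (fun v => v.toList)).filter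
            (fun g => List.IsChain (· ≠ ·) (c :: g))))).filter
        (fun x => x.2.1 ≠ x.2.2 ∧
          (x.2.1 ++ x.2.2.reverse).foldl (fun v d => μ d v) (μ c x.1) =
            μ c ((x.2.1 ++ x.2.2.reverse).foldl (fun v d => μ d v) x.1))).card := by
  classical
  set C1 := ((Finset.univ : Finset (Fin n)) ×ˢ ((((Finset.univ : Finset (List.Vector (Fin 3) (k + 1))).image (fun v => v.toList)).filter
            (fun g => List.IsChain (· ≠ ·) (c :: g))) ×ˢ
          (((Finset.univ : Finset (List.Vector (Fin 3) (k + 1))).image (fun v => v.toList)).filter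
            (fun g => List.IsChain (· ≠ ·) (c :: g))))).filter
        (fun x => x.2.1 ≠ x.2.2 ∧
          (x.2.1 ++ x.2.2.reverse).foldl (fun v d => μ d v) (μ c x.1) =
            μ c ((x.2.1 ++ x.2.2.reverse).foldl (fun v d => μ d v) x.1)) with hC1
  set Sm := ((Finset.univ : Finset (Fin n)) ×ˢ
          ((Finset.univ : Finset (List.Vector (Fin 3) (2 * (k + 1)))).image (fun v => v.toList))).filter
        (fun aw => List.IsChain (· ≠ ·) (c :: (aw.2 ++ [c])) ∧
          aw.2.foldl (fun v d => μ d v) (μ c aw.1) = μ c (aw.2.foldl (fun v d => μ d v) aw.1)) with hSm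
  set C0 := ((Finset.univ : Finset (Fin n)) ×ˢ ((((Finset.univ : Finset (List.Vector (Fin 3) k)).image (fun v => v.toList)).filter
            (fun g => List.IsChain (· ≠ ·) (c :: g))) ×ˢ
          (((Finset.univ : Finset (List.Vector (Fin 3) k)).image (fun v => v.toList)).filter
            (fun g => List.IsChain (· ≠ ·) (c :: g))))).filter
        (fun x => x.2.1 ≠ x.2.2 ∧
          (x.2.1 ++ x.2.2.reverse).foldl (fun v d => μ d v) (μ c x.1) =
            μ c ((x.2.1 ++ x.2.2.reverse).foldl (fun v d => μ d v) x.1)) with hC0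
  -- unpacking membership in `C1`
  have memC1 : ∀ x ∈ C1, ∃ gi d gi' d', x.2.1 = gi ++ [d] ∧ x.2.2 = gi' ++ [d'] ∧ gi.length = k ∧ gi'.length = k ∧
      List.IsChain (· ≠ ·) (c :: (gi ++ [d])) ∧ List.IsChain (· ≠ ·) (c :: (gi' ++ [d'])) ∧ x.2.1 ≠ x.2.2 ∧
      (x.2.1 ++ x.2.2.reverse).foldl (fun v d => μ d v) (μ c x.1) =
        μ c ((x.2.1 ++ x.2.2.reverse).foldl (fun v d => μ d v) x.1) := by
    intro x hx
    rw [hC1, Finset.mem_filter, Finset.mem_product, Finset.mem_product, mem_cont, mem_cont] at hx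
    obtain ⟨⟨-, ⟨hl, hch⟩, ⟨hl', hch'⟩⟩, hne, hcomm⟩ := hx
    obtain ⟨gi, d, hgd, hgi⟩ := exists_concat_of_length hl
    obtain ⟨gi', d', hgd', hgi'⟩ := exists_concat_of_length hl'
    refine ⟨gi, d, gi', d', hgd, hgd', hgi, hgi', hgd ▸ hch, hgd' ▸ hch', hne, hcomm⟩
  -- (A) different last letters: a structure of length `2k + 2`
  have hA : (C1.filter (fun x => x.2.1.getLast? ≠ x.2.2.getLast?)).card ≤ Sm.card := by
    refine Finset.card_le_card_of_injOn (fun x => (x.1, x.2.1 ++ x.2.2.reverse)) ?_ ?_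
    · intro x hx
      obtain ⟨hx1, hP⟩ := Finset.mem_filter.1 (Finset.mem_coe.1 hx)
      obtain ⟨gi, d, gi', d', hg, hg', hgi, hgi', hch, hch', -, hcomm⟩ := memC1 x hx1
      have hdd : d ≠ d' := by
        rw [hg, hg', List.getLast?_concat, List.getLast?_concat] at hP
        exact fun h => hP (by rw [h])
      refine Finset.mem_coe.2 (Finset.mem_filter.2 ⟨Finset.mem_product.2 ⟨Finset.mem_univ _, ?_⟩, ?_, hcomm⟩)
      · show x.2.1 ++ x.2.2.reverse ∈ _
        rw [mem_words, hg, hg']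
        simp [hgi, hgi']
        ring
      · show List.IsChain (· ≠ ·) (c :: ((x.2.1 ++ x.2.2.reverse) ++ [c]))
        rw [hg, hg']
        exact isChain_glue hch hch' hdd
    · intro x hx y hy h
      obtain ⟨hx1, -⟩ := Finset.mem_filter.1 (Finset.mem_coe.1 hx)
      obtain ⟨hy1, -⟩ := Finset.mem_filter.1 (Finset.mem_coe.1 hy)
      obtain ⟨gi, d, gi', d', hg, -, hgi, -, -⟩ := memC1 x hx1
      obtain ⟨hi, e, hi', e', hh, -, hhi, -, -⟩ := memC1 y hy1
      simp only [Prod.mk.injEq] at h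
      obtain ⟨ha, happ⟩ := h
      have hlen : x.2.1.length = y.2.1.length := by rw [hg, hh]; simp [hgi, hhi]
      obtain ⟨h1, h2⟩ := List.append_inj happ hlen
      exact Prod.ext ha (Prod.ext h1 (List.reverse_injective h2))
  -- (B) equal last letters: strip them, at most 2-to-1 into `C0`
  have hBimg : (C1.filter (fun x => x.2.1.getLast? = x.2.2.getLast?)).image
      (fun x => (x.1, x.2.1.dropLast, x.2.2.dropLast)) ⊆ C0 := by
    intro y hy
    obtain ⟨x, hx, rfl⟩ := Finset.mem_image.1 hy
    obtain ⟨hx1, hP⟩ := Finset.mem_filter.1 hx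
    obtain ⟨gi, d, gi', d', hg, hg', hgi, hgi', hch, hch', hne, hcomm⟩ := memC1 x hx1
    have hdd : d = d' := by
      rw [hg, hg', List.getLast?_concat, List.getLast?_concat] at hP
      exact Option.some.inj hP
    subst hdd
    rw [hC0, Finset.mem_filter, Finset.mem_product, Finset.mem_product, mem_cont, mem_cont]
    simp only [hg, hg', List.dropLast_concat]
    refine ⟨⟨Finset.mem_univ _, ⟨hgi, isChain_init hch⟩, ⟨hgi', isChain_init hch'⟩⟩, ?_, ?_⟩
    · intro h
      apply hne
      rw [hg, hg', h]
    · rw [← foldl_strip μ hμ gi gi' d, ← foldl_strip μ hμ gi gi' d, ← hg, ← hg']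
      exact hcomm
  have hBfib : ∀ b ∈ (C1.filter (fun x => x.2.1.getLast? = x.2.2.getLast?)).image
      (fun x => (x.1, x.2.1.dropLast, x.2.2.dropLast)),
      ((C1.filter (fun x => x.2.1.getLast? = x.2.2.getLast?)).filter
        (fun x => (x.1, x.2.1.dropLast, x.2.2.dropLast) = b)).card ≤ 2 := by
    intro b _
    -- the last letter of `c b.2.1` is excluded for the stripped letter
    obtain ⟨L, e₀, hLe⟩ : ∃ L e₀, c :: b.2.1 = L ++ [e₀] := by
      obtain ⟨L, e₀, h⟩ := (List.eq_nil_or_concat (c :: b.2.1)).resolve_left (List.cons_ne_nil _ _)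
      exact ⟨L, e₀, by rw [h, List.concat_eq_append]⟩
    have key : ∀ x ∈ (C1.filter (fun x => x.2.1.getLast? = x.2.2.getLast?)).filter
        (fun x => (x.1, x.2.1.dropLast, x.2.2.dropLast) = b),
        ∃ d, d ≠ e₀ ∧ x = (b.1, b.2.1 ++ [d], b.2.2 ++ [d]) := by
      intro x hx
      obtain ⟨hx', hfx⟩ := Finset.mem_filter.1 hx
      obtain ⟨hx1, hP⟩ := Finset.mem_filter.1 hx'
      obtain ⟨gi, d, gi', d', hg, hg', -, -, hch, -, -, -⟩ := memC1 x hx1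
      have hdd : d = d' := by
        rw [hg, hg', List.getLast?_concat, List.getLast?_concat] at hP
        exact Option.some.inj hP
      subst hdd
      rw [hg, hg', List.dropLast_concat, List.dropLast_concat] at hfx
      obtain ⟨hxb, rfl, rfl⟩ : x.1 = b.1 ∧ gi = b.2.1 ∧ gi' = b.2.2 := by
        rw [← hfx]; exact ⟨rfl, rfl, rfl⟩
      refine ⟨d, ?_, Prod.ext hxb (Prod.ext hg hg')⟩
      · intro hde
        subst hde
        have e : c :: (b.2.1 ++ [d]) = (c :: b.2.1) ++ [d] := rfl
        rw [e, hLe, List.append_assoc] at hch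
        simp at hch
    refine le_trans (Finset.card_le_card_of_injOn (fun x => x.2.1.getLast?.getD c) (t := Finset.univ.erase e₀)
      ?_ ?_) ?_
    · intro x hx
      obtain ⟨d, hde, rfl⟩ := key x (Finset.mem_coe.1 hx)
      refine Finset.mem_coe.2 (Finset.mem_erase.2 ⟨?_, Finset.mem_univ _⟩)
      simpa using hde
    · intro x hx y hy h
      obtain ⟨d, -, rfl⟩ := key x (Finset.mem_coe.1 hx)
      obtain ⟨d', -, rfl⟩ := key y (Finset.mem_coe.1 hy)
      have : d = d' := by simpa using h
      rw [this]
    · rw [Finset.card_erase_of_mem (Finset.mem_univ _), Finset.card_univ, Fintype.card_fin]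
  have hB : (C1.filter (fun x => x.2.1.getLast? = x.2.2.getLast?)).card ≤ 2 * C0.card :=
    (Finset.card_le_mul_card_image _ 2 hBfib).trans (Nat.mul_le_mul_left 2 (Finset.card_le_card hBimg))
  -- assemble
  have hsplit := Finset.card_filter_add_card_filter_not (s := C1) (fun x => x.2.1.getLast? = x.2.2.getLast?)
  have hA' : (C1.filter (fun x => ¬ x.2.1.getLast? = x.2.2.getLast?)).card ≤ Sm.card := hA
  omega

/-- **The same-colour supply inequality** (crux NOTES (15.1), density-free): for every colour `c`, `0 < n` and
`k`, with `Π_m(c)` the number of same-colour structures `(a, w)` of colour `c` and length `m` (`c w c` reduced,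
`(μ c a) · w = μ c (a · w)`):
`4^k ≤ n · 2^k + Σ_{j < k} 2^j · Π_{2(k - j)}(c)`.
With `2^k ≥ 2n` the right-hand sum is at least `4^k / 2`, so SOME scale `m = 2(k - j) ≤ 2k` carries
`Π_m(c) ≥ 2^m · 2^{(2k - m)/2} / (2k)` structures (`exists_scale`). [this line, NOTES §15.1] -/
theorem sameColour_supply (μ : Fin 3 → Equiv.Perm (Fin n)) (hμ : ∀ d, μ d * μ d = 1) (hn : 0 < n)
    (c : Fin 3) (k : ℕ) :
    4 ^ k ≤ n * 2 ^ k + ∑ j ∈ Finset.range k, 2 ^ j *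
      (((Finset.univ : Finset (Fin n)) ×ˢ
          ((Finset.univ : Finset (List.Vector (Fin 3) (2 * (k - j)))).image (fun v => v.toList))).filter
        (fun aw => List.IsChain (· ≠ ·) (c :: (aw.2 ++ [c])) ∧
          aw.2.foldl (fun v d => μ d v) (μ c aw.1) = μ c (aw.2.foldl (fun v d => μ d v) aw.1))).card := by
  classical
  -- unrolled suffix stripping: `|Coll_k| ≤ Σ_{j<k} 2^j Π_{2(k-j)}`
  have hunroll : ∀ k : ℕ,
      (((Finset.univ : Finset (Fin n)) ×ˢ
        ((((Finset.univ : Finset (List.Vector (Fin 3) k)).image (fun v => v.toList)).filter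
            (fun g => List.IsChain (· ≠ ·) (c :: g))) ×ˢ
          (((Finset.univ : Finset (List.Vector (Fin 3) k)).image (fun v => v.toList)).filter
            (fun g => List.IsChain (· ≠ ·) (c :: g))))).filter
        (fun x => x.2.1 ≠ x.2.2 ∧
          (x.2.1 ++ x.2.2.reverse).foldl (fun v d => μ d v) (μ c x.1) =
            μ c ((x.2.1 ++ x.2.2.reverse).foldl (fun v d => μ d v) x.1))).card ≤
      ∑ j ∈ Finset.range k, 2 ^ j *
        (((Finset.univ : Finset (Fin n)) ×ˢ
            ((Finset.univ : Finset (List.Vector (Fin 3) (2 * (k - j)))).image (fun v => v.toList))).filter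
          (fun aw => List.IsChain (· ≠ ·) (c :: (aw.2 ++ [c])) ∧
            aw.2.foldl (fun v d => μ d v) (μ c aw.1) = μ c (aw.2.foldl (fun v d => μ d v) aw.1))).card := by
    intro k
    induction k with
    | zero =>
      rw [Finset.sum_range_zero, Nat.le_zero, Finset.card_eq_zero, Finset.filter_eq_empty_iff]
      intro x hx
      rw [Finset.mem_product, Finset.mem_product, mem_cont, mem_cont] at hx
      obtain ⟨-, ⟨hl, -⟩, ⟨hl', -⟩⟩ := hx
      rw [List.length_eq_zero_iff] at hl hl'
      exact fun h => h.1 (hl.trans hl'.symm)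
    | succ k ih =>
      refine (coll_strip μ hμ c k).trans ?_
      rw [Finset.sum_range_succ']
      simp only [pow_zero, one_mul, Nat.sub_zero]
      refine (add_le_add le_rfl ?_).trans_eq (add_comm _ _)
      · refine (Nat.mul_le_mul_left 2 ih).trans (le_of_eq ?_)
        rw [Finset.mul_sum]
        refine Finset.sum_congr rfl fun j _ => ?_
        rw [pow_succ, Nat.add_sub_add_right]
        ring
  exact (coll_lower μ hμ hn c k).trans (Nat.add_le_add_left (hunroll k) _)

/-- **Some scale is rich in same-colour structures** (pigeonhole on `sameColour_supply`): if `2^k ≥ 2n` then for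
some `j < k` the scale `m = 2(k - j)` has `2k · 2^j · Π_m(c) ≥ 4^k`. [this line, NOTES §15.1] -/
theorem exists_scale (μ : Fin 3 → Equiv.Perm (Fin n)) (hμ : ∀ d, μ d * μ d = 1) (hn : 0 < n) (c : Fin 3)
    (k : ℕ) (hk : 2 * n ≤ 2 ^ k) :
    ∃ j < k, 4 ^ k ≤ 2 * k * (2 ^ j *
      (((Finset.univ : Finset (Fin n)) ×ˢ
          ((Finset.univ : Finset (List.Vector (Fin 3) (2 * (k - j)))).image (fun v => v.toList))).filter
        (fun aw => List.IsChain (· ≠ ·) (c :: (aw.2 ++ [c])) ∧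
          aw.2.foldl (fun v d => μ d v) (μ c aw.1) = μ c (aw.2.foldl (fun v d => μ d v) aw.1))).card) := by
  have hsup := sameColour_supply μ hμ hn c k
  by_contra hcon
  simp only [not_exists, not_and, not_le] at hcon
  have hlt : ∑ j ∈ Finset.range k, 2 * k * (2 ^ j *
      (((Finset.univ : Finset (Fin n)) ×ˢ
          ((Finset.univ : Finset (List.Vector (Fin 3) (2 * (k - j)))).image (fun v => v.toList))).filter
        (fun aw => List.IsChain (· ≠ ·) (c :: (aw.2 ++ [c])) ∧
          aw.2.foldl (fun v d => μ d v) (μ c aw.1) = μ c (aw.2.foldl (fun v d => μ d v) aw.1))).card) <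
      ∑ j ∈ Finset.range k, 4 ^ k := by
    have hk0 : 0 < k := by
      rcases Nat.eq_zero_or_pos k with rfl | h
      · simp at hk; omega
      · exact h
    exact Finset.sum_lt_sum_of_nonempty (Finset.nonempty_range_iff.2 hk0.ne') fun j hj =>
      hcon j (Finset.mem_range.1 hj)
  rw [Finset.sum_const, Finset.card_range, smul_eq_mul, ← Finset.mul_sum] at hlt
  have h4 : 4 ^ k = 2 ^ k * 2 ^ k := by rw [show (4 : ℕ) = 2 * 2 by norm_num, mul_pow]
  have hn2 : n * 2 ^ k * 2 ≤ 4 ^ k := by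
    rw [h4]
    calc n * 2 ^ k * 2 = (2 * n) * 2 ^ k := by ring
      _ ≤ 2 ^ k * 2 ^ k := Nat.mul_le_mul_right _ hk
  nlinarith

/-- **Registered form** (`stub_sameColourSupplyDyadic`, a `--supports` sub-goal of crux `stmt-MatrixMultiplication-10883`):
the same-colour supply inequality (15.1) with dyadic weights, `sameColour_supply` fully quantified. -/
theorem stub_sameColourSupplyDyadic : ∀ (n k : ℕ) (μ : Fin 3 → Equiv.Perm (Fin n)) (c : Fin 3), (∀ d, μ d * μ d = 1) → 0 < n → 4 ^ k ≤ n * 2 ^ k + ∑ j ∈ Finset.range k, 2 ^ j * (((Finset.univ : Finset (Fin n)) ×ˢ ((Finset.univ : Finset (List.Vector (Fin 3) (2 * (k - j)))).image (fun v => v.toList))).filter (fun aw => List.IsChain (· ≠ ·) (c :: (aw.2 ++ [c])) ∧ aw.2.foldl (fun v d => μ d v) (μ c aw.1) = μ c (aw.2.foldl (fun v d => μ d v) aw.1))).card :=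
  fun _ k μ c hμ hn => sameColour_supply μ hμ hn c k

end Summit.MatrixMultiplication.MatrixMultiplication.Theorems.HyperoctahedralThreshold.SameColourSupply
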